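import Summits.QuantumFields.YangMills.Theorems.BalabanUVNodesN21GappedPairRoadK3V6KnitSignFree

/-!
# N21 (NE7c) · THE PAIR ROAD WITH (H-ζ) DISCHARGED FROM THE PROVISOS ROW `zetaMeas` (director-ym №228, def-level repair R2)

R134 seat `pub-ymgap-dag-n21-d` (g16, lane owner N21), strategy s2; key K3⁸ `SpineGivenEndpointR13SepCoPHV` = stmt-QuantumFields-27366, `--kind proof --supports 27366 --as helper`;
COUNT-NEUTRAL.  Theorems only (0 `def`).  Every statement below is a LANDED pair-road theorem (V3 p642482 `…PairRoadK3V6Knit`, dag-n21-w2's `…PairRoadK3V6KnitOfCloseness`,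
V8 p646377 `…PairRoadK3V6KnitSignFree`) with its displayed (H-ζ) binder
`hζm : ∀ F θ, θ.Provisos₁₃CoPH F 2 → ((θ.ZhUnity F 2 ∧ θ.SlotsNondegenerate₁₃ F 2) ∧ LiveSel F θ) → θ.Admissible F 2 → ZetaMeasurable F 2 θ.ζ`
DISCHARGED by the provisos' own row: `fun F θ hP _ _ => hP.zetaMeas` — the one-liner №228 licenses once `Stage13HParams.Provisos₁₃CoPH.zetaMeas` exists (the lane's LOCATED-ζ,
evidence #49 on 27366; plan l.41117; director №228).  Nothing else changes: the dial rows, K4, N20's ∕ N19′'s binders and node U5's Target stay displayed exactly as before.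

WHAT IS PROVED (kernel; [bookkeeping]; NO estimate): ★★★ `keyedShellWeight_of_gap2Pin_zeta` — N21's v6 face `KeyedShellWeight cr` on the pair-pinned reading with rows = the
DIALS ONLY (`0 ≤ ρ, ρ′ ≤ 1`, `Σ_K (1∕(n₁ K+1) + 1∕(n₂ K+1)) < ∞`); ★★★ `keyedExtraction_of_gap2Pin_zeta` — N27x's faces `KeyedExtractionBFree cr ∧ KeyedExtractionV cr` with NO row;
`exists_gap2Pinned_faces_zeta` ∕ `exists_gap2Pinned_faces_cutZero_zeta` (the ∃-faces forms); ★★★ `spineGivenEndpointR13SepCoPHV_of_gap2Road_zeta` (K3⁸ BY NAME on the pair road: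
dials, K4, N20 witness, N19′ witness, Target — no (H-ζ)); ★★★ `spineGivenEndpointR13SepCoPHV_of_gap2Road_cutZero_zeta` (the FEWEST binders: dials, K4, N19′ sandwich, Target).

HONEST FRAMING (binding).  Compositions BY NAME; NO estimate of Bałaban's; NE7c at print's FIXED thresholds NOT PRINTED ∕ NOT proved; K4 ∕ N20 ∕ N19′ ∕ Target are HYPOTHESES
(N19′'s sandwich NOT PRINTED for `d = 4`; inhabited for no family, K0⁷ OPEN); NOT `stub_expansion13HV` (its `PinnedAtLive` names `crOfRecord₁₃V`; the pair pin is the plan's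
DEFER-UNTIL, l.40982); N21 NOT discharged at the v6 pin; K3⁸ NOT claimed; counts UNMOVED (typed 28∕28 · discharged 5∕27); never a count claim.  No `sorry`, no `def`, no `instance`,
no `notation`; standard axioms.  One finite four-torus programme at fixed `ε` — NOT ℝ⁴, NOT OS, NOT a mass gap, NOT the Clay problem.
-/

set_option autoImplicit false

noncomputable section

open scoped BigOperators

namespace Summit.QuantumFields.YangMills.Theorems.N21GappedRoadK3V6Knit

open Literature.MathematicalPhysics.QuantumFieldTheory.Balaban1983to89
open Literature.MathematicalPhysics.QuantumFieldTheory.Balaban1983to89.T4Continuum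
open Literature.MathematicalPhysics.QuantumFieldTheory.Balaban1983to89.Node00
open T4WeightBudget (RelWeightBound)
open T4ContinuumYM4Torus (ForSmallCouplings)
open Summit.QuantumFields.BalabanUV.T4Continuum.Spine
open YMDAG.UVSplit (classSet₁₃ badClass₁₃)
open Summit.QuantumFields.YangMills.Theorems.K3V5Defs (SpineReading RateReadingFn CutReading KeyedRelWeight KeyedShellWeight LiveSel PHolderD4)
open Summit.QuantumFields.YangMills.Theorems.K3V6Defs (KeyedRatesHolderD4V KeyedCoreEdgeHolderD4V KeyedExtractionV KeyedExtractionBFree)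
open Summit.QuantumFields.YangMills.BalabanUVNodes.N20OffLiveOneTermReading (crOneTerm₁₃)
open Summit.QuantumFields.YangMills.Theorems.N21ShellSplitOfRecord13CoPH (WidthLetter₁₃CoPH DepthLetter₁₃CoPH)
open Summit.QuantumFields.YangMills.Theorems.N21GappedTopPair13CoPH (crGap2₁₃V gapWeight2A₁₃ gapWeight2B₁₃ gapCore2A₁₃ gapCore2B₁₃)
open Summit.QuantumFields.YangMills.Theorems.N21GappedPairRoadK3V6KnitOfCloseness (keyedShellWeight_of_gap2Pin_signFree spineGivenEndpointR13SepCoPHV_of_gap2Road_signFree)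

/-! ## §1 The pair pin: N21's and N27x's faces with (H-ζ) discharged -/

section Gap2PinZeta

/-- ★★★ **N21's v6 FACE ON THE PAIR-PINNED READING, (H-ζ) DISCHARGED** — `KeyedShellWeight cr` for `cr` pinned to `crGap2₁₃V 2 (jc …) ρ ρ′ n₁ n₂` on the live line and to
`crOneTerm₁₃ 0` off it; rows: `0 ≤ ρ_K, ρ′_K ≤ 1` and `Σ_K (1∕(n₁ K+1) + 1∕(n₂ K+1)) < ∞` ONLY (dag-n21-w2's `keyedShellWeight_of_gap2Pin_signFree` with `hζm := hP.zetaMeas`;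
all binders explicit — the pin rows `hon` ∕ `hoff` and the two dial rows, nothing else). [bookkeeping] -/
theorem keyedShellWeight_of_gap2Pin_zeta (jc : CutReading) (ρ ρ' : WidthLetter₁₃CoPH 2) (n₁ n₂ : DepthLetter₁₃CoPH 2) {cr : SpineReading}
    (hon : ∀ (F : T4Family) (θ : Stage13HParams F 2) (hP : θ.Provisos₁₃CoPH F 2) (g₀ : ℕ → ℝ) (os : List (ULoop F)),
      LiveSel F θ → cr F θ hP g₀ os = crGap2₁₃V 2 (jc F θ hP g₀ os) ρ ρ' n₁ n₂ F θ hP g₀ os)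
    (hoff : ∀ (F : T4Family) (θ : Stage13HParams F 2) (hP : θ.Provisos₁₃CoPH F 2) (g₀ : ℕ → ℝ) (os : List (ULoop F)),
      ¬ LiveSel F θ → cr F θ hP g₀ os = crOneTerm₁₃ 0 F θ hP g₀ os)
    (hρ : ∀ (F : T4Family) (θ : Stage13HParams F 2) (hP : θ.Provisos₁₃CoPH F 2) (g₀ : ℕ → ℝ) (os : List (ULoop F)) (K : ℕ),
      (0 ≤ ρ F θ hP g₀ os K ∧ ρ F θ hP g₀ os K ≤ 1) ∧ (0 ≤ ρ' F θ hP g₀ os K ∧ ρ' F θ hP g₀ os K ≤ 1))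
    (hn : ∀ (F : T4Family) (θ : Stage13HParams F 2) (hP : θ.Provisos₁₃CoPH F 2) (g₀ : ℕ → ℝ) (os : List (ULoop F)),
      Summable (fun K => 1 / ((n₁ F θ hP g₀ os K : ℝ) + 1) + 1 / ((n₂ F θ hP g₀ os K : ℝ) + 1))) :
    KeyedShellWeight cr :=
  keyedShellWeight_of_gap2Pin_signFree jc ρ ρ' n₁ n₂ hon hoff (fun _ _ hP _ _ => hP.zetaMeas) hρ hn

/-- ★★★ **N27x's faces ON THE PAIR-PINNED READING — NO ROW beyond the pin** (V3's `keyedExtraction_of_gap2Pin` with `hζm := hP.zetaMeas`; binders = the pin rows `hon` ∕ `hoff`). [bookkeeping] -/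
theorem keyedExtraction_of_gap2Pin_zeta (jc : CutReading) (ρ ρ' : WidthLetter₁₃CoPH 2) (n₁ n₂ : DepthLetter₁₃CoPH 2) {cr : SpineReading}
    (hon : ∀ (F : T4Family) (θ : Stage13HParams F 2) (hP : θ.Provisos₁₃CoPH F 2) (g₀ : ℕ → ℝ) (os : List (ULoop F)),
      LiveSel F θ → cr F θ hP g₀ os = crGap2₁₃V 2 (jc F θ hP g₀ os) ρ ρ' n₁ n₂ F θ hP g₀ os)
    (hoff : ∀ (F : T4Family) (θ : Stage13HParams F 2) (hP : θ.Provisos₁₃CoPH F 2) (g₀ : ℕ → ℝ) (os : List (ULoop F)),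
      ¬ LiveSel F θ → cr F θ hP g₀ os = crOneTerm₁₃ 0 F θ hP g₀ os) :
    KeyedExtractionBFree cr ∧ KeyedExtractionV cr :=
  keyedExtraction_of_gap2Pin jc ρ ρ' n₁ n₂ hon hoff (fun _ _ hP _ _ => hP.zetaMeas)

end Gap2PinZeta

/-! ## §2 The pair road: the ∃-faces forms and the two END-shapes with (H-ζ) discharged -/

section Gap2RoadZeta

variable (ρ ρ' : WidthLetter₁₃CoPH 2) (n₁ n₂ : DepthLetter₁₃CoPH 2)

/-- ★★ **UNDER A PAIR PIN THERE IS A SPINE READING CARRYING ALL FOUR K5 FACES** — V8's `exists_gap2Pinned_faces_signFree` with (H-ζ) discharged; rows: dials, N20 witness, N19′ witness,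
Target. [bookkeeping] -/
theorem exists_gap2Pinned_faces_zeta (β : ℝ) (rr : RateReadingFn) (jc : CutReading)
    (hρ : ∀ (F : T4Family) (θ : Stage13HParams F 2) (hP : θ.Provisos₁₃CoPH F 2) (g₀ : ℕ → ℝ) (os : List (ULoop F)) (K : ℕ),
      (0 ≤ ρ F θ hP g₀ os K ∧ ρ F θ hP g₀ os K ≤ 1) ∧ (0 ≤ ρ' F θ hP g₀ os K ∧ ρ' F θ hP g₀ os K ≤ 1))
    (hn : ∀ (F : T4Family) (θ : Stage13HParams F 2) (hP : θ.Provisos₁₃CoPH F 2) (g₀ : ℕ → ℝ) (os : List (ULoop F)),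
      Summable (fun K => 1 / ((n₁ F θ hP g₀ os K : ℝ) + 1) + 1 / ((n₂ F θ hP g₀ os K : ℝ) + 1)))
    (h20 : ∀ (F : T4Family) (θ : Stage13HParams F 2) (hP : θ.Provisos₁₃CoPH F 2), ((θ.ZhUnity F 2 ∧ θ.SlotsNondegenerate₁₃ F 2) ∧ LiveSel F θ) → θ.Admissible F 2 →
      ∀ (g₀ : ℕ → ℝ) (os : List (ULoop F)),
        ∃ W : ℕ → ℝ, RelWeightBound 1 (classSet₁₃ θ 0 g₀)
          (gapWeight2A₁₃ θ hP 0 g₀ os (ρ F θ hP g₀ os) (ρ' F θ hP g₀ os) (n₁ F θ hP g₀ os) (n₂ F θ hP g₀ os))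
          (gapWeight2B₁₃ θ hP 0 g₀ os (ρ F θ hP g₀ os) (ρ' F θ hP g₀ os) (n₁ F θ hP g₀ os) (n₂ F θ hP g₀ os)) (badClass₁₃ θ 0 g₀ (jc F θ hP g₀ os)) W)
    (h19 : ∀ (F : T4Family) (θ : Stage13HParams F 2) (h : θ.Provisos₁₃SepCoPH F 2) (v : Revision₁₃ F 2 θ h),
      ((θ.ZhUnity F 2 ∧ θ.SlotsNondegenerate₁₃ F 2) ∧ LiveSel F θ) → θ.Admissible F 2 →
      B16.EndStatementBPrinted (datumOfRecord₁₃SepCoPHV F 2 θ h v).C → DagBinding.EndpointExistence (datumOfRecord₁₃SepCoPHV F 2 θ h v).C.toB12 →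
        ForSmallCouplings (datumOfRecord₁₃SepCoPHV F 2 θ h v) fun g₀ => ∀ os : List (ULoop F),
          PHolderD4 β (datumOfRecord₁₃SepCoPHV F 2 θ h v) (rr F θ h.toCore g₀ os) →
            letI : DecidableEq (Σ K, SiteSeqKey F (0 + K)) := Classical.decEq _
            ∃ δ : ℕ → ℝ, NE7.Core 1 (F.side ^ 4) (classSet₁₃ θ 0 g₀) (badClass₁₃ θ 0 g₀ (jc F θ h.toCore g₀ os))
              (gapCore2A₁₃ θ h.toCore 0 g₀ os (ρ F θ h.toCore g₀ os) (ρ' F θ h.toCore g₀ os) (n₁ F θ h.toCore g₀ os) (n₂ F θ h.toCore g₀ os))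
              (gapCore2B₁₃ θ h.toCore 0 g₀ os (ρ F θ h.toCore g₀ os) (ρ' F θ h.toCore g₀ os) (n₁ F θ h.toCore g₀ os) (n₂ F θ h.toCore g₀ os)) δ ∧ Summable δ)
    (htarget : ∀ (F : T4Family) (θ : Stage13HParams F 2) (hP : θ.Provisos₁₃CoPH F 2), ((θ.ZhUnity F 2 ∧ θ.SlotsNondegenerate₁₃ F 2) ∧ ¬ LiveSel F θ) → θ.Admissible F 2 →
      ∀ (g₀ : ℕ → ℝ) (os : List (ULoop F)), PHolderD4 β (datumOfRecord₁₃CoPH F 2 θ hP) (rr F θ hP g₀ os) →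
        ∃ δ : ℕ → ℝ, NE7.Target ((F.side : ℝ) ^ 4) 1 δ (fun K => T4GenFunBounds.schemeZ ((datumOfRecord₁₃CoPH F 2 θ hP).scheme g₀) os (0 + K))) :
    ∃ cr : SpineReading,
      (∀ (F : T4Family) (θ : Stage13HParams F 2) (hP : θ.Provisos₁₃CoPH F 2) (g₀ : ℕ → ℝ) (os : List (ULoop F)),
        LiveSel F θ → cr F θ hP g₀ os = crGap2₁₃V 2 (jc F θ hP g₀ os) ρ ρ' n₁ n₂ F θ hP g₀ os) ∧
      (∀ (F : T4Family) (θ : Stage13HParams F 2) (hP : θ.Provisos₁₃CoPH F 2) (g₀ : ℕ → ℝ) (os : List (ULoop F)),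
        ¬ LiveSel F θ → cr F θ hP g₀ os = crOneTerm₁₃ 0 F θ hP g₀ os) ∧
      KeyedRelWeight cr ∧ KeyedShellWeight cr ∧ KeyedExtractionV cr ∧ KeyedCoreEdgeHolderD4V β cr rr :=
  exists_gap2Pinned_faces_signFree β rr jc ρ ρ' n₁ n₂ (fun _ _ hP _ _ => hP.zetaMeas) hρ hn h20 h19 htarget

/-- ★★★ **K3⁸ ON THE PAIR ROAD, PIN-FREE, (H-ζ) DISCHARGED.**  Displayed: the dial rows; K4; N20's WITNESS at the doubly-gapped carriers on the live line; N19′'s WITNESS at the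
doubly-gapped cores (slot-keyed, under the prefix and `PHolderD4 β`); node U5's Target off the line — dag-n21-w2's `spineGivenEndpointR13SepCoPHV_of_gap2Road_signFree` with
`hζm := hP.zetaMeas`.  Every displayed binder a HYPOTHESIS; CONDITIONAL; NOT `stub_expansion13HV`; K3⁸ NOT claimed. [bookkeeping] -/
theorem spineGivenEndpointR13SepCoPHV_of_gap2Road_zeta (β : ℝ) (rr : RateReadingFn) (jc : CutReading)
    (hρ : ∀ (F : T4Family) (θ : Stage13HParams F 2) (hP : θ.Provisos₁₃CoPH F 2) (g₀ : ℕ → ℝ) (os : List (ULoop F)) (K : ℕ),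
      (0 ≤ ρ F θ hP g₀ os K ∧ ρ F θ hP g₀ os K ≤ 1) ∧ (0 ≤ ρ' F θ hP g₀ os K ∧ ρ' F θ hP g₀ os K ≤ 1))
    (hn : ∀ (F : T4Family) (θ : Stage13HParams F 2) (hP : θ.Provisos₁₃CoPH F 2) (g₀ : ℕ → ℝ) (os : List (ULoop F)),
      Summable (fun K => 1 / ((n₁ F θ hP g₀ os K : ℝ) + 1) + 1 / ((n₂ F θ hP g₀ os K : ℝ) + 1)))
    (hr : KeyedRatesHolderD4V β rr)
    (h20 : ∀ (F : T4Family) (θ : Stage13HParams F 2) (hP : θ.Provisos₁₃CoPH F 2), ((θ.ZhUnity F 2 ∧ θ.SlotsNondegenerate₁₃ F 2) ∧ LiveSel F θ) → θ.Admissible F 2 →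
      ∀ (g₀ : ℕ → ℝ) (os : List (ULoop F)),
        ∃ W : ℕ → ℝ, RelWeightBound 1 (classSet₁₃ θ 0 g₀)
          (gapWeight2A₁₃ θ hP 0 g₀ os (ρ F θ hP g₀ os) (ρ' F θ hP g₀ os) (n₁ F θ hP g₀ os) (n₂ F θ hP g₀ os))
          (gapWeight2B₁₃ θ hP 0 g₀ os (ρ F θ hP g₀ os) (ρ' F θ hP g₀ os) (n₁ F θ hP g₀ os) (n₂ F θ hP g₀ os)) (badClass₁₃ θ 0 g₀ (jc F θ hP g₀ os)) W)
    (h19 : ∀ (F : T4Family) (θ : Stage13HParams F 2) (h : θ.Provisos₁₃SepCoPH F 2) (v : Revision₁₃ F 2 θ h),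
      ((θ.ZhUnity F 2 ∧ θ.SlotsNondegenerate₁₃ F 2) ∧ LiveSel F θ) → θ.Admissible F 2 →
      B16.EndStatementBPrinted (datumOfRecord₁₃SepCoPHV F 2 θ h v).C → DagBinding.EndpointExistence (datumOfRecord₁₃SepCoPHV F 2 θ h v).C.toB12 →
        ForSmallCouplings (datumOfRecord₁₃SepCoPHV F 2 θ h v) fun g₀ => ∀ os : List (ULoop F),
          PHolderD4 β (datumOfRecord₁₃SepCoPHV F 2 θ h v) (rr F θ h.toCore g₀ os) →
            letI : DecidableEq (Σ K, SiteSeqKey F (0 + K)) := Classical.decEq _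
            ∃ δ : ℕ → ℝ, NE7.Core 1 (F.side ^ 4) (classSet₁₃ θ 0 g₀) (badClass₁₃ θ 0 g₀ (jc F θ h.toCore g₀ os))
              (gapCore2A₁₃ θ h.toCore 0 g₀ os (ρ F θ h.toCore g₀ os) (ρ' F θ h.toCore g₀ os) (n₁ F θ h.toCore g₀ os) (n₂ F θ h.toCore g₀ os))
              (gapCore2B₁₃ θ h.toCore 0 g₀ os (ρ F θ h.toCore g₀ os) (ρ' F θ h.toCore g₀ os) (n₁ F θ h.toCore g₀ os) (n₂ F θ h.toCore g₀ os)) δ ∧ Summable δ)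
    (htarget : ∀ (F : T4Family) (θ : Stage13HParams F 2) (hP : θ.Provisos₁₃CoPH F 2), ((θ.ZhUnity F 2 ∧ θ.SlotsNondegenerate₁₃ F 2) ∧ ¬ LiveSel F θ) → θ.Admissible F 2 →
      ∀ (g₀ : ℕ → ℝ) (os : List (ULoop F)), PHolderD4 β (datumOfRecord₁₃CoPH F 2 θ hP) (rr F θ hP g₀ os) →
        ∃ δ : ℕ → ℝ, NE7.Target ((F.side : ℝ) ^ 4) 1 δ (fun K => T4GenFunBounds.schemeZ ((datumOfRecord₁₃CoPH F 2 θ hP).scheme g₀) os (0 + K))) :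
    Summit.QuantumFields.YangMills.Theses.BalabanUVNodes.SpineGivenEndpointR13SepCoPHV :=
  spineGivenEndpointR13SepCoPHV_of_gap2Road_signFree β rr jc ρ ρ' n₁ n₂ (fun _ _ hP _ _ => hP.zetaMeas) hρ hn hr h20 h19 htarget

/-- ★★★ **K3⁸ ON THE PAIR ROAD AT THE ZERO CUT, PIN-FREE, (H-ζ) DISCHARGED — THE FEWEST BINDERS**: the dial rows; K4 `KeyedRatesHolderD4V β rr`; N19′ = the one-constant NE7
sandwich between the two runs' DOUBLY-GAPPED cores on EVERY keyed class (NOT PRINTED for `d = 4`); node U5's Target off the live line.  N20 ∕ N21 ∕ N27x by theorem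
(V8's `spineGivenEndpointR13SepCoPHV_of_gap2Road_cutZero_signFree` with `hζm := hP.zetaMeas`).  CONDITIONAL; NOT `stub_expansion13HV`; K3⁸ NOT claimed. [bookkeeping] -/
theorem spineGivenEndpointR13SepCoPHV_of_gap2Road_cutZero_zeta (β : ℝ) (rr : RateReadingFn)
    (hρ : ∀ (F : T4Family) (θ : Stage13HParams F 2) (hP : θ.Provisos₁₃CoPH F 2) (g₀ : ℕ → ℝ) (os : List (ULoop F)) (K : ℕ),
      (0 ≤ ρ F θ hP g₀ os K ∧ ρ F θ hP g₀ os K ≤ 1) ∧ (0 ≤ ρ' F θ hP g₀ os K ∧ ρ' F θ hP g₀ os K ≤ 1))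
    (hn : ∀ (F : T4Family) (θ : Stage13HParams F 2) (hP : θ.Provisos₁₃CoPH F 2) (g₀ : ℕ → ℝ) (os : List (ULoop F)),
      Summable (fun K => 1 / ((n₁ F θ hP g₀ os K : ℝ) + 1) + 1 / ((n₂ F θ hP g₀ os K : ℝ) + 1)))
    (hr : KeyedRatesHolderD4V β rr)
    (h19 : ∀ (F : T4Family) (θ : Stage13HParams F 2) (h : θ.Provisos₁₃SepCoPH F 2) (v : Revision₁₃ F 2 θ h),
      ((θ.ZhUnity F 2 ∧ θ.SlotsNondegenerate₁₃ F 2) ∧ LiveSel F θ) → θ.Admissible F 2 →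
      B16.EndStatementBPrinted (datumOfRecord₁₃SepCoPHV F 2 θ h v).C → DagBinding.EndpointExistence (datumOfRecord₁₃SepCoPHV F 2 θ h v).C.toB12 →
        ForSmallCouplings (datumOfRecord₁₃SepCoPHV F 2 θ h v) fun g₀ => ∀ os : List (ULoop F),
          PHolderD4 β (datumOfRecord₁₃SepCoPHV F 2 θ h v) (rr F θ h.toCore g₀ os) →
            ∃ δ : ℕ → ℝ, (∀ K : ℕ, ∃ c : ℝ, ∀ t : ℝ, |t| ≤ 1 → ∀ x ∈ classSet₁₃ θ 0 g₀ K,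
              Real.exp (c - F.side ^ 4 * δ K) *
                  gapCore2A₁₃ θ h.toCore 0 g₀ os (ρ F θ h.toCore g₀ os) (ρ' F θ h.toCore g₀ os) (n₁ F θ h.toCore g₀ os) (n₂ F θ h.toCore g₀ os) K t x ≤
                gapCore2B₁₃ θ h.toCore 0 g₀ os (ρ F θ h.toCore g₀ os) (ρ' F θ h.toCore g₀ os) (n₁ F θ h.toCore g₀ os) (n₂ F θ h.toCore g₀ os) K t x ∧
              gapCore2B₁₃ θ h.toCore 0 g₀ os (ρ F θ h.toCore g₀ os) (ρ' F θ h.toCore g₀ os) (n₁ F θ h.toCore g₀ os) (n₂ F θ h.toCore g₀ os) K t x ≤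
                Real.exp (c + F.side ^ 4 * δ K) *
                  gapCore2A₁₃ θ h.toCore 0 g₀ os (ρ F θ h.toCore g₀ os) (ρ' F θ h.toCore g₀ os) (n₁ F θ h.toCore g₀ os) (n₂ F θ h.toCore g₀ os) K t x) ∧ Summable δ)
    (htarget : ∀ (F : T4Family) (θ : Stage13HParams F 2) (hP : θ.Provisos₁₃CoPH F 2), ((θ.ZhUnity F 2 ∧ θ.SlotsNondegenerate₁₃ F 2) ∧ ¬ LiveSel F θ) → θ.Admissible F 2 →
      ∀ (g₀ : ℕ → ℝ) (os : List (ULoop F)), PHolderD4 β (datumOfRecord₁₃CoPH F 2 θ hP) (rr F θ hP g₀ os) →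
        ∃ δ : ℕ → ℝ, NE7.Target ((F.side : ℝ) ^ 4) 1 δ (fun K => T4GenFunBounds.schemeZ ((datumOfRecord₁₃CoPH F 2 θ hP).scheme g₀) os (0 + K))) :
    Summit.QuantumFields.YangMills.Theses.BalabanUVNodes.SpineGivenEndpointR13SepCoPHV :=
  spineGivenEndpointR13SepCoPHV_of_gap2Road_cutZero_signFree ρ ρ' n₁ n₂ β rr (fun _ _ hP _ _ => hP.zetaMeas) hρ hn hr h19 htarget

/-- ★★ **UNDER A PAIR PIN AT THE ZERO CUT THERE IS A SPINE READING CARRYING ALL FOUR K5 FACES**, (H-ζ) discharged — V8's `exists_gap2Pinned_faces_cutZero_signFree` with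
`hζm := hP.zetaMeas`; rows: dials, N19′ all-classes witness, Target. [bookkeeping] -/
theorem exists_gap2Pinned_faces_cutZero_zeta (β : ℝ) (rr : RateReadingFn)
    (hρ : ∀ (F : T4Family) (θ : Stage13HParams F 2) (hP : θ.Provisos₁₃CoPH F 2) (g₀ : ℕ → ℝ) (os : List (ULoop F)) (K : ℕ),
      (0 ≤ ρ F θ hP g₀ os K ∧ ρ F θ hP g₀ os K ≤ 1) ∧ (0 ≤ ρ' F θ hP g₀ os K ∧ ρ' F θ hP g₀ os K ≤ 1))
    (hn : ∀ (F : T4Family) (θ : Stage13HParams F 2) (hP : θ.Provisos₁₃CoPH F 2) (g₀ : ℕ → ℝ) (os : List (ULoop F)),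
      Summable (fun K => 1 / ((n₁ F θ hP g₀ os K : ℝ) + 1) + 1 / ((n₂ F θ hP g₀ os K : ℝ) + 1)))
    (h19 : ∀ (F : T4Family) (θ : Stage13HParams F 2) (h : θ.Provisos₁₃SepCoPH F 2) (v : Revision₁₃ F 2 θ h),
      ((θ.ZhUnity F 2 ∧ θ.SlotsNondegenerate₁₃ F 2) ∧ LiveSel F θ) → θ.Admissible F 2 →
      B16.EndStatementBPrinted (datumOfRecord₁₃SepCoPHV F 2 θ h v).C → DagBinding.EndpointExistence (datumOfRecord₁₃SepCoPHV F 2 θ h v).C.toB12 →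
        ForSmallCouplings (datumOfRecord₁₃SepCoPHV F 2 θ h v) fun g₀ => ∀ os : List (ULoop F),
          PHolderD4 β (datumOfRecord₁₃SepCoPHV F 2 θ h v) (rr F θ h.toCore g₀ os) →
            ∃ δ : ℕ → ℝ, (∀ K : ℕ, ∃ c : ℝ, ∀ t : ℝ, |t| ≤ 1 → ∀ x ∈ classSet₁₃ θ 0 g₀ K,
              Real.exp (c - F.side ^ 4 * δ K) *
                  gapCore2A₁₃ θ h.toCore 0 g₀ os (ρ F θ h.toCore g₀ os) (ρ' F θ h.toCore g₀ os) (n₁ F θ h.toCore g₀ os) (n₂ F θ h.toCore g₀ os) K t x ≤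
                gapCore2B₁₃ θ h.toCore 0 g₀ os (ρ F θ h.toCore g₀ os) (ρ' F θ h.toCore g₀ os) (n₁ F θ h.toCore g₀ os) (n₂ F θ h.toCore g₀ os) K t x ∧
              gapCore2B₁₃ θ h.toCore 0 g₀ os (ρ F θ h.toCore g₀ os) (ρ' F θ h.toCore g₀ os) (n₁ F θ h.toCore g₀ os) (n₂ F θ h.toCore g₀ os) K t x ≤
                Real.exp (c + F.side ^ 4 * δ K) *
                  gapCore2A₁₃ θ h.toCore 0 g₀ os (ρ F θ h.toCore g₀ os) (ρ' F θ h.toCore g₀ os) (n₁ F θ h.toCore g₀ os) (n₂ F θ h.toCore g₀ os) K t x) ∧ Summable δ)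
    (htarget : ∀ (F : T4Family) (θ : Stage13HParams F 2) (hP : θ.Provisos₁₃CoPH F 2), ((θ.ZhUnity F 2 ∧ θ.SlotsNondegenerate₁₃ F 2) ∧ ¬ LiveSel F θ) → θ.Admissible F 2 →
      ∀ (g₀ : ℕ → ℝ) (os : List (ULoop F)), PHolderD4 β (datumOfRecord₁₃CoPH F 2 θ hP) (rr F θ hP g₀ os) →
        ∃ δ : ℕ → ℝ, NE7.Target ((F.side : ℝ) ^ 4) 1 δ (fun K => T4GenFunBounds.schemeZ ((datumOfRecord₁₃CoPH F 2 θ hP).scheme g₀) os (0 + K))) :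
    ∃ cr : SpineReading,
      (∀ (F : T4Family) (θ : Stage13HParams F 2) (hP : θ.Provisos₁₃CoPH F 2) (g₀ : ℕ → ℝ) (os : List (ULoop F)),
        LiveSel F θ → cr F θ hP g₀ os = crGap2₁₃V 2 (fun _ => 0) ρ ρ' n₁ n₂ F θ hP g₀ os) ∧
      (∀ (F : T4Family) (θ : Stage13HParams F 2) (hP : θ.Provisos₁₃CoPH F 2) (g₀ : ℕ → ℝ) (os : List (ULoop F)),
        ¬ LiveSel F θ → cr F θ hP g₀ os = crOneTerm₁₃ 0 F θ hP g₀ os) ∧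
      KeyedRelWeight cr ∧ KeyedShellWeight cr ∧ KeyedExtractionV cr ∧ KeyedCoreEdgeHolderD4V β cr rr :=
  exists_gap2Pinned_faces_cutZero_signFree ρ ρ' n₁ n₂ β rr (fun _ _ hP _ _ => hP.zetaMeas) hρ hn h19 htarget

end Gap2RoadZeta

end Summit.QuantumFields.YangMills.Theorems.N21GappedRoadK3V6Knit

end
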